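import Literature.AlgebraicGeometry.HodgeTheory.NodalFormPencilNonsingular
import Literature.Geometry.ComplexAnalytic.HolomorphicMorseLemma
import Mathlib.Analysis.Calculus.FDeriv.CompCLM
import HarnessLib

/-!
# The holomorphic Morse chart at an ordinary double point of a projective hypersurface

Family `hodge`, layer `Literature/AlgebraicGeometry/HodgeTheory`, next to `PicardLefschetzNodalForms` (vocabulary
`IsOrdinaryDoublePointOf`) and `NodalFormPencilNonsingular` (the Hessian is injective on a coordinate slice through the
node).  Written by the prover seat `hodge-nonav-prover-Bx` (g12, cell `hodge-nonav`) for the Picard–Lefschetz binders hPL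
(`picardLefschetz_nodalForms_uniform`) and hB2 (`picardLefschetz_symmetricA3`) of crux K1-B of
`Summits/HodgeConjecture/HodgeConjecture/Theses/SignSymmetricPowers.lean` (stmt-HodgeConjecture-19716): the local
theory of a node of the universal family of hypersurfaces (Voisin II §2.3.1–2.3.2, §3.2.1: "the Hessian of a local
equation of `V(f)` at `[p]` is non-degenerate", so by the holomorphic Morse lemma the local equation is `Σ zᵢ²` in
suitable holomorphic coordinates, and the Milnor fibre is the standard `A₁` fibre of the tree's Brieskorn–Pham model
`PhamBrieskornCyclicNode*` with all exponents `2`) starts with THIS chart.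

* `IsOrdinaryDoublePointOf.exists_holomorphicMorseChart` — for a form `f` of degree `d ≥ 1` on `ℙⁿ⁺¹_ℂ` with an
  ordinary double point `p` and a coordinate `m` with `p_m ≠ 0`, the local equation of `V(f)` on the affine slice
  `x_m = p_m` through `p`, parametrized by the remaining `n + 1` coordinates `w ↦ p + insertNth m 0 w`, has a
  holomorphic Morse chart `Θ` at `w = 0`: `f(p + insertNth m 0 w) = Σᵢ (Θ w)ᵢ²` on `Θ.source ∋ 0`, `Θ 0 = 0`, `Θ`
  complex differentiable and real `C^∞`, `Θ.symm` real `C^∞` (the output format of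
  `PhamBrieskorn.exists_cyclicNodePencil_morseChart` and of the tree's holomorphic Morse lemma
  `Geometry.ComplexAnalytic.HolomorphicMorse.exists_holomorphicMorseChart`, of which this is the instance: the second
  derivative of the slice equation at `0` is the Hessian of `f` restricted to the slice, non-degenerate by
  `IsOrdinaryDoublePointOf.eq_zero_of_hessian_mulVec_eq_zero` and Euler's relation).

## References

* [VoisinHodgeII2003] C. Voisin, *Hodge Theory and Complex Algebraic Geometry II*, CUP 2003, §2.1.1 (Morse lemma,
  Lemma 2.7–Cor. 2.8: the Hessian of the local equation at an ordinary double point), §2.3.1–2.3.2, §3.2.1.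
* [Milnor1963] J. Milnor, *Morse theory*, Lemma 2.2.
-/

noncomputable section

open MvPolynomial Metric Set Filter
open scoped Topology ContDiff
open Literature.AlgebraicGeometry.Motives
open Literature.Geometry.ComplexAnalytic

namespace Literature.AlgebraicGeometry.HodgeTheory

section HodgeTheory

variable {n : ℕ}

/-- The partial derivatives of a polynomial commute. [folklore] -/
private theorem pderiv_pderiv_comm {σ R : Type*} [CommSemiring R] (i j : σ) (P : MvPolynomial σ R) :
    pderiv i (pderiv j P) = pderiv j (pderiv i P) := by
  classical
  induction P using MvPolynomial.induction_on with
  | C a => simp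
  | add p q hp hq => simp [map_add, hp, hq]
  | mul_X p k h =>
    simp only [Derivation.leibniz, map_add, h, pderiv_X, smul_eq_mul]
    by_cases hik : i = k <;> by_cases hjk : j = k <;> simp [hik, hjk] <;> ring

/-- **The holomorphic Morse chart at an ordinary double point.**  Let `f` be a form of degree `d ≥ 1` on `ℙⁿ⁺¹_ℂ`
with an ordinary double point `p` (`IsOrdinaryDoublePointOf`: `∇f(p) = 0`, Hessian of rank `n + 1`) and let `p_m ≠ 0`.
On the affine slice `x_m = p_m` through `p`, parametrized by `w : Fin (n + 1) → ℂ ↦ p + insertNth m 0 w`, the local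
equation `w ↦ f(p + insertNth m 0 w)` has a holomorphic Morse chart at `0`: an open partial homeomorphism `Θ` of
`Fin (n + 1) → ℂ` with `0 ∈ Θ.source`, `Θ 0 = 0`, `Θ` complex differentiable and real `C^∞` on `Θ.source`, `Θ.symm`
real `C^∞` on `Θ.target`, and `f(p + insertNth m 0 w) = Σᵢ (Θ w)ᵢ²` on `Θ.source` (Voisin II §2.1.1: the Hessian of
the local equation at an ordinary double point is non-degenerate; holomorphic Morse lemma, Milnor Lemma 2.2).
[cite: VoisinHodgeII2003, §2.1.1 (Lemma 2.7, Cor. 2.8) and §2.3.1] [cite: Milnor1963, Lemma 2.2] -/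
theorem IsOrdinaryDoublePointOf.exists_holomorphicMorseChart {d : ℕ} {f : MvPolynomial (Fin (n + 2)) ℂ}
    {p : Fin (n + 2) → ℂ} (hf : f.IsHomogeneous d) (hd : 1 ≤ d) (h : IsOrdinaryDoublePointOf f p)
    {m : Fin (n + 2)} (hm : p m ≠ 0) :
    ∃ Θ : OpenPartialHomeomorph (Fin (n + 1) → ℂ) (Fin (n + 1) → ℂ),
      (0 : Fin (n + 1) → ℂ) ∈ Θ.source ∧ Θ 0 = 0 ∧
      DifferentiableOn ℂ Θ Θ.source ∧ ContDiffOn ℝ ∞ Θ Θ.source ∧ ContDiffOn ℝ ∞ Θ.symm Θ.target ∧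
      ∀ w ∈ Θ.source, eval (p + Fin.insertNth m (0 : ℂ) w) f = ∑ i, (Θ w i) ^ 2 := by
  classical
  -- the slice embedding as a continuous linear map
  let J : (Fin (n + 1) → ℂ) →L[ℂ] (Fin (n + 2) → ℂ) :=
    ContinuousLinearMap.pi (Fin.insertNth m (0 : (Fin (n + 1) → ℂ) →L[ℂ] ℂ)
      (fun j => ContinuousLinearMap.proj (R := ℂ) (φ := fun _ : Fin (n + 1) => ℂ) j))
  have hJm : ∀ w, J w m = 0 := fun w => by
    simp [J, Fin.insertNth_apply_same]
  have hJs : ∀ w (j : Fin (n + 1)), J w (m.succAbove j) = w j := fun w j => by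
    simp [J, Fin.insertNth_apply_succAbove]
  have hJ : ∀ w, J w = Fin.insertNth m (0 : ℂ) w := by
    intro w
    refine (Fin.insertNth_eq_iff.2 ⟨(hJm w).symm, ?_⟩).symm
    funext j
    rw [Fin.removeNth_apply, hJs]
  -- the slice equation and its first derivative
  set φ : (Fin (n + 1) → ℂ) → ℂ := fun w => eval (p + J w) f with hφ
  have hφd' : ∀ (F : MvPolynomial (Fin (n + 2)) ℂ) (w : Fin (n + 1) → ℂ),
      HasFDerivAt (fun w => eval (p + J w) F) ((evalDeriv F (p + J w)).comp J) w := by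
    intro F w
    exact (hasFDerivAt_mvPolynomial_eval F (p + J w)).comp w (J.hasFDerivAt.const_add p)
  have hφd : DifferentiableOn ℂ φ univ := fun w _ => (hφd' f w).differentiableAt.differentiableWithinAt
  have hgrad0 : evalDeriv f p = 0 := by
    ext v
    rw [evalDeriv_apply]
    simp [h.eval_pderiv]
  have hφ1 : fderiv ℂ φ 0 = 0 := by
    rw [hφ, (hφd' f 0).fderiv, map_zero, add_zero, hgrad0, ContinuousLinearMap.zero_comp]
  -- the second derivative at `0`
  let E' : (Fin (n + 1) → ℂ) →L[ℂ] (Fin (n + 2) → ℂ) →L[ℂ] ℂ :=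
    ∑ j, (((evalDeriv (pderiv j f) p).comp J).smulRight
      (ContinuousLinearMap.proj (R := ℂ) (φ := fun _ : Fin (n + 2) => ℂ) j) :
        (Fin (n + 1) → ℂ) →L[ℂ] (Fin (n + 2) → ℂ) →L[ℂ] ℂ)
  have hE : HasFDerivAt (fun w => evalDeriv f (p + J w)) E' 0 := by
    have h1 : HasFDerivAt (fun w => ∑ j, eval (p + J w) (pderiv j f) •
        (ContinuousLinearMap.proj (R := ℂ) (φ := fun _ : Fin (n + 2) => ℂ) j)) E' 0 := by
      refine HasFDerivAt.fun_sum fun j _ => ?_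
      have h2 := hφd' (pderiv j f) 0
      rw [map_zero, add_zero] at h2
      exact (h2.smul_const (ContinuousLinearMap.proj (R := ℂ) (φ := fun _ : Fin (n + 2) => ℂ) j) :)
    refine h1.congr_of_eventuallyEq (Eventually.of_forall fun w => ?_)
    rfl
  set L : (Fin (n + 1) → ℂ) →L[ℂ] (Fin (n + 1) → ℂ) →L[ℂ] ℂ :=
    (((ContinuousLinearMap.compL ℂ (Fin (n + 1) → ℂ) (Fin (n + 2) → ℂ) ℂ).flip J)).comp E' with hL
  have hφ2 : HasFDerivAt (fderiv ℂ φ) L 0 := by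
    have hfd : fderiv ℂ φ = fun w => (evalDeriv f (p + J w)).comp J := funext fun w => (hφd' f w).fderiv
    rw [hfd, hL]
    exact ((ContinuousLinearMap.compL ℂ (Fin (n + 1) → ℂ) (Fin (n + 2) → ℂ) ℂ).flip J).hasFDerivAt.comp 0 hE
  have hLapply : ∀ u v, L u v = ∑ j, (∑ i, eval p (pderiv i (pderiv j f)) * J u i) * J v j := by
    intro u v
    simp only [hL, E', ContinuousLinearMap.comp_apply, ContinuousLinearMap.flip_apply, ContinuousLinearMap.compL_apply,
      FunLike.coe_sum, Finset.sum_apply, ContinuousLinearMap.smulRight_apply, ContinuousLinearMap.proj_apply,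
      FunLike.coe_smul, Pi.smul_apply, smul_eq_mul, evalDeriv_apply]
  -- non-degeneracy: the Hessian is injective on the slice (and Euler for the `m`-th equation)
  have hLnd : ∀ u, (∀ v, L u v = 0) → u = 0 := by
    intro u hu
    set V := J u with hV
    have hc : ∀ l, l ≠ m → ∑ i, eval p (pderiv i (pderiv l f)) * V i = 0 := by
      intro l hl
      obtain ⟨j, rfl⟩ := Fin.exists_succAbove_eq hl
      have h1 := hu (Pi.single j 1)
      rw [hLapply] at h1
      rw [← h1]
      symm
      rw [Finset.sum_eq_single (m.succAbove j)]
      · rw [hJs, Pi.single_eq_same, mul_one]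
      · intro k _ hk
        by_cases hkm : k = m
        · rw [hkm, hJm, mul_zero]
        · obtain ⟨j', rfl⟩ := Fin.exists_succAbove_eq hkm
          rw [hJs, Pi.single_eq_of_ne (fun h' => hk (by rw [h'])), mul_zero]
      · exact fun h' => (h' (Finset.mem_univ _)).elim
    have hcm : ∑ i, eval p (pderiv i (pderiv m f)) * V i = 0 := by
      -- Euler: `Σ_l p_l (Σ_i ∂_i∂_l f(p) V_i) = Σ_i V_i (d-1) ∂_i f(p) = 0`
      have hE : ∑ l, p l * ∑ i, eval p (pderiv i (pderiv l f)) * V i = 0 := by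
        calc ∑ l, p l * ∑ i, eval p (pderiv i (pderiv l f)) * V i
            = ∑ i, V i * ∑ l, p l * eval p (pderiv l (pderiv i f)) := by
              simp_rw [Finset.mul_sum]
              rw [Finset.sum_comm]
              refine Finset.sum_congr rfl fun i _ => Finset.sum_congr rfl fun l _ => ?_
              rw [pderiv_pderiv_comm i l]
              ring
          _ = 0 := Finset.sum_eq_zero fun i _ => by
              rw [sum_mul_eval_pderiv_eq (hf.pderiv (i := i)) p, h.eval_pderiv i, mul_zero, mul_zero]
      rw [← Finset.add_sum_erase _ _ (Finset.mem_univ m)] at hE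
      have hrest : ∑ l ∈ Finset.univ.erase m, p l * ∑ i, eval p (pderiv i (pderiv l f)) * V i = 0 :=
        Finset.sum_eq_zero fun l hl => by rw [hc l (Finset.ne_of_mem_erase hl), mul_zero]
      rw [hrest, add_zero] at hE
      exact (mul_eq_zero.1 hE).resolve_left hm
    have hV0 : V = 0 := by
      refine h.eq_zero_of_hessian_mulVec_eq_zero hf hm (hJm u) fun l => ?_
      by_cases hl : l = m
      · rw [hl]; exact hcm
      · exact hc l hl
    funext j
    rw [← hJs u j, ← hV, hV0, Pi.zero_apply, Pi.zero_apply]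
  -- the holomorphic Morse lemma
  obtain ⟨Θ, h0, hΘ0, -, hΘd, hΘcd, hΘsymm, hΘf⟩ :=
    HolomorphicMorse.exists_holomorphicMorseChart isOpen_univ hφd (mem_univ 0) hφ1 hφ2 hLnd
  refine ⟨Θ, h0, hΘ0, hΘd, hΘcd, hΘsymm, fun w hw => ?_⟩
  have hφ0 : φ 0 = 0 := by
    rw [hφ]
    simp only [map_zero, add_zero]
    exact h.eval_eq_zero hf hd
  have h' := hΘf w hw
  rw [hφ0, zero_add] at h'
  rw [← hJ]
  exact h'

end HodgeTheory

end Literature.AlgebraicGeometry.HodgeTheory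

end
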